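import Summits.ResolutionOfSingularities.ResolutionOfSingularities.Theorems.PurelyInseparableDim4ResConeCornerEntry
import Summits.ResolutionOfSingularities.ResolutionOfSingularities.Theorems.PurelyInseparableDim4ResConeLinearReframe
import HarnessLib
import HarnessLib.Audit.Tags

/-!
# Purely inseparable four-folds — ONE LINEAR RE-FRAMING AT A LETTER CHANGE: the tilt of the polar kernel along
# the free letters is straightened by p-11's W-frame move riding the walk, the initial-degree law survives it,
# and `…CornerEntry` finishes — no constant-`(d, e_G = 2)` tail on two permanent light boundary letters whose
# kernel tilts only along free letters (K2(p) lane, SLICE C (C7d, part 2), file-holder res-dim4-p-5 g3)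

[OURS · counted 0 · cell `res-dim4-pi` · K2(p) lane (desk WORDS #78 (d), #80 (d), #96 (b)) · seat res-dim4-p-5 g3,
over brick (ii) FILE E (res-dim4-p-11 g3: `FrameChange.exists_isWitnessedChain_cleanTsch`, (E3), (E4)).]
Nothing here proves K2(p), `NoIsolatedTrap p p` or resolution of singularities in dimension ≥ 4 /
characteristic `p`.

Letter-level facts (linear data ride linearly, the initial-degree law survives, one kernel vector transports):
`…ResConeLinearReframe` (part 2a).
* §3 **`exists_reframed_tail`** — re-framing a whole TAIL (all hypotheses of `…CornerEntry` carried: isolated,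
  witnessed, `x^r ∣ F`, floor, shade, `e_G ≡ 2` (linear data, band), letters, boundary, light, free
  translations) with the kernel at time `0` moved by `w ↦ w + (Σ cᵢ wᵢ)·e_f` and the initial-degree law kept;
* §4 **`no_tilt_at_letter_change`** — THE TRANSFER THEOREM: no isolated above-floor witnessed `Step0 p` chain with
  `x^{r₀} ∣ F₀` has a tail (from `k₀`) of constant natural shade `d < p`, `e_G ≡ 2`, chart letters in `{a, a′}`,
  permanent light boundary letters, free translations, and a letter change `a′ → a` at whose child the polar kernel
  is `⟨e_a + α, e_{a′} + β⟩` with `α, β` supported on two FREE letters `f₁, f₂`.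
Located residual of slice C after this file: tails where the kernel tilts along a PASSIVE BOUNDARY letter, heavy
letters (`r_a + r_{a′} > 2 r_new`: idea-4's B∞), lossy / translated-boundary steps, and `e_G ≡ 3` (slice B).
[cite: CossartJannsenSaito2020, Thm. 3.10(4), Thm. 3.14, Lemma 13.2, Lemma 13.4, Thm. 13.7]
bears_on: LADDER-RESOLUTION:D157-DOOR2 (res-dim4-pi · K2(p) = `RidgeBudget.NoAboveFloorTrap p p` · slice C).
Supports stmt-ResolutionOfSingularities-16155 (helper).
-/

set_option linter.dupNamespace false -- mandated namespace of this single-conjunct summit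

noncomputable section

namespace Summit.ResolutionOfSingularities.ResolutionOfSingularities.Theorems.PIDim4

namespace ResCone

open MvPolynomial Finset
open Literature.AlgebraicGeometry.Resolution
open Literature.AlgebraicGeometry.Resolution.CentreBlowup
open Literature.AlgebraicGeometry.Resolution.Hauser2010
open Literature.AlgebraicGeometry.Resolution.HauserPerlega2019
open PointBlowup (polarMap additiveSubspace direction translate)
open FrameChange (tsch)

variable {K : Type} [Field K]

/-! ## 3. Re-framing a tail along one free letter -/

section Transfer

variable (p : ℕ) [Fact p.Prime] [CharP K p] [DecidableEq K]

/-- **RE-FRAMING A TAIL ALONG ONE FREE LETTER** (`FrameChange.exists_isWitnessedChain_cleanTsch` + (E3) + (E4),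
linear datum `Σ cᵢ xᵢ`, `c_f = 0`): all the hypotheses of `…CornerEntry` are carried, the polar kernel at time
`0` moves by `w ∈ V′ ↔ w + (Σ cᵢ wᵢ)·e_f ∈ V`, and the initial-degree law for a letter `a′ ≠ f` at time `0` is kept.
[OURS] [cite: CossartJannsenSaito2020, Thm. 3.10(4), Thm. 3.14] -/
theorem exists_reframed_tail {c : ℕ → State K} {j : ℕ → Fin 4} {β : ℕ → Fin 4 → K}
    (hc : ∀ k, IsIsolated p (c k).F ∧ Step0 p (c k) (c (k + 1))) (hw : FreeTail.IsWitnessedChain p c j β)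
    (hr0 : ∀ e ∈ (c 0).F.support, (c 0).r ≤ e) (hfloor : ∀ k, ordZero (c k).F ≠ p)
    (hclean : deletePthPowers p (c 0).F = (c 0).F) {d : ℕ} (hshade : ∀ k, (c k).shade = (d : ℕ∞))
    (he : ∀ k, Module.finrank K (resVertex (c k)) = 2)
    (hfreeT : ∀ k, ∀ i, β k i ≠ 0 → (c k).r i = 0)
    {f : Fin 4} (hjf : ∀ k, j k ≠ f) (hrf : (c 0).r f = 0) (hef : f ∉ (c 0).exc)
    (lam : Fin 4 → K) (hlam : lam f = 0) {a' : Fin 4} (haf : a' ≠ f) {N : ℕ}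
    (hP : ∀ E ∈ (c 0).F.support, E a' = (c 0).r a' → E.degree = N) :
    ∃ (c' : ℕ → State K) (b : ℕ → Fin 4 → K),
      (∀ k, IsIsolated p (c' k).F ∧ Step0 p (c' k) (c' (k + 1))) ∧ FreeTail.IsWitnessedChain p c' j b ∧
      (∀ e ∈ (c' 0).F.support, (c' 0).r ≤ e) ∧ (∀ k, ordZero (c' k).F ≠ p) ∧
      deletePthPowers p (c' 0).F = (c' 0).F ∧ (∀ k, (c' k).shade = (d : ℕ∞)) ∧
      (∀ k, Module.finrank K (resVertex (c' k)) = 2) ∧ (∀ k, ∀ i, b k i ≠ 0 → (c' k).r i = 0) ∧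
      (∀ k, (c' k).r = (c k).r ∧ (c' k).exc = (c k).exc) ∧
      (∀ w : Fin 4 → K, w ∈ resVertex (c' 0) ↔ Function.update w f (w f + ∑ i, lam i * w i) ∈ resVertex (c 0)) ∧
      (∀ E ∈ (c' 0).F.support, E a' = (c' 0).r a' → E.degree = N) := by
  obtain ⟨φ, b, hφ0, hadm, hb, hrec, hw'⟩ := FrameChange.exists_isWitnessedChain_cleanTsch p hw hclean hjf hrf hef
    (FrameChange.not_mem_vars_linear hlam)
    (FrameChange.constantCoeff_eq_zero_of_isHomogeneous_one (FrameChange.isHomogeneous_linear lam))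
  -- the datum stays linear with vanishing `f`-coefficient
  have hlin : ∀ k, ∃ μ : Fin 4 → K, μ f = 0 ∧ φ k = ∑ i, C (μ i) * X i := by
    intro k
    induction k with
    | zero => exact ⟨lam, hlam, hφ0⟩
    | succ k ih =>
      obtain ⟨μ, hμf, hμ⟩ := ih
      refine ⟨Function.update μ (j k) 0, ?_, ?_⟩
      · rw [Function.update_apply]
        split_ifs
        · rfl
        · exact hμf
      · rw [hrec k, hμ, next_linear]
  have hcleank : ∀ k, deletePthPowers p (c k).F = (c k).F := FrameChange.clean_of_isWitnessedChain p hw hclean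
  have hfreek : ∀ k, (c k).r f = 0 ∧ f ∉ (c k).exc := FrameChange.free_of_isWitnessedChain hw hjf hrf hef
  have hrk : ∀ k, ∀ e ∈ (c k).F.support, (c k).r ≤ e := IsolatedBand.isolated_chain_forall_le hc hr0
  have hband : ∀ k, ∃ o : ℕ, ordZero (c k).F = o ∧ p < o ∧ o < 2 * p := fun k => chain_band p hc hfloor k
  have hord : ∀ k, ordZero (deletePthPowers p (tsch f (φ k) (c k).F)) = ordZero (c k).F := fun k =>
    FrameChange.ordZero_clean_tsch p (hadm k).1 (hadm k).2 (hcleank k)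
  have hiso : ∀ k, IsIsolated p (deletePthPowers p (tsch f (φ k) (c k).F)) := fun k =>
    (FrameChange.isIsolated_clean_tsch_iff p (hadm k).1 (hadm k).2 _).mpr (hc k).1
  have hstep0 := FrameChange.step0_of_isWitnessedChain hw'
  refine ⟨fun k => ⟨deletePthPowers p (tsch f (φ k) (c k).F), (c k).r, (c k).exc⟩, b,
    fun k => ⟨hiso k, hstep0 k⟩, hw', ?_, fun k => ?_, PointBlowup.deletePthPowers_deletePthPowers p _,
    fun k => ?_, fun k => ?_, fun k i hbi => ?_, fun k => ⟨rfl, rfl⟩, fun w => ?_, ?_⟩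
  · exact FrameChange.forall_le_of_mem_support_clean_tsch p (hfreek 0).1 hr0
  · show ordZero (deletePthPowers p (tsch f (φ k) (c k).F)) ≠ p
    rw [hord k]; exact hfloor k
  · rw [← hshade k]
    exact FrameChange.shade_cleanTschState p (hadm k).1 (hadm k).2 (hcleank k)
  · obtain ⟨μ, hμf, hμ⟩ := hlin k
    obtain ⟨o, ho, hpo, ho2⟩ := hband k
    have h := FrameChange.finrank_resVertex_cleanTschState_linear p hμf (hfreek k).1 (hrk k) ho
      (not_dvd_of_lt_of_lt_two_mul hpo ho2)
    show Module.finrank K (resVertex (⟨deletePthPowers p (tsch f (φ k) (c k).F), (c k).r, (c k).exc⟩ : State K)) = 2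
    rw [hμ, h]
    exact he k
  · show (c k).r i = 0
    by_cases hif : i = f
    · rw [hif]; exact (hfreek k).1
    · have hbk : b k i = β k i := by rw [hb k, Function.update_of_ne hif]
      exact hfreeT k i (by rw [← hbk]; exact hbi)
  · obtain ⟨o, ho, hpo, ho2⟩ := hband 0
    have h := FrameChange.mem_resVertex_cleanTschState_linear_iff p hlam (hfreek 0).1 (hrk 0) ho
      (not_dvd_of_lt_of_lt_two_mul hpo ho2) w
    show w ∈ resVertex (⟨deletePthPowers p (tsch f (φ 0) (c 0).F), (c 0).r, (c 0).exc⟩ : State K) ↔ _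
    rw [hφ0]
    exact h
  · show ∀ E ∈ (deletePthPowers p (tsch f (φ 0) (c 0).F)).support, E a' = (c 0).r a' → E.degree = N
    rw [hφ0]
    exact initialDegree_clean_tsch_linear p haf lam (hrk 0) hP

/-! ## 4. The transfer theorem -/

/-- **NO TILT AT A LETTER CHANGE** (every prime): no isolated above-floor witnessed `Step0 p` chain with
`x^{r₀} ∣ F₀` has, from some `k₀` on, constant natural shade `d < p`, `e_G ≡ 2`, chart letters in `{a, a′}`,
permanent boundary letters `a, a′`, light letters, free translations, and a letter change `j k₁ = a′`,
`j (k₁ + 1) = a` at whose child the polar kernel is `⟨e_a + α, e_{a′} + γ⟩` with the tilts `α, γ` supported on two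
FREE letters `f₁, f₂` (`r = 0`, not exceptional there).  One linear re-framing along `f₁` then `f₂`
(`exists_reframed_tail`) straightens the kernel while keeping the initial-degree law of the `a′`-step, and
`no_frame_of_initialDegree` ends the chain. [OURS]
[cite: CossartJannsenSaito2020, Thm. 3.10(4), Thm. 3.14, Lemma 13.2, Lemma 13.4, Thm. 13.7] -/
theorem no_tilt_at_letter_change {c : ℕ → State K} {j : ℕ → Fin 4} {β : ℕ → Fin 4 → K}
    (hc : ∀ k, IsIsolated p (c k).F ∧ Step0 p (c k) (c (k + 1))) (hw : FreeTail.IsWitnessedChain p c j β)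
    (hr0 : ∀ e ∈ (c 0).F.support, (c 0).r ≤ e) (hfloor : ∀ k, ordZero (c k).F ≠ p) {k₀ d : ℕ} (hdp : d < p)
    (hshade : ∀ k, k₀ ≤ k → (c k).shade = (d : ℕ∞)) {a a' : Fin 4} (haa : a ≠ a')
    (hletters : ∀ k, k₀ ≤ k → (j k = a ∨ j k = a'))
    (he : ∀ k, k₀ ≤ k → Module.finrank K (resVertex (c k)) = 2)
    (hbdry : ∀ k, k₀ ≤ k → 1 ≤ (c k).r a ∧ 1 ≤ (c k).r a')
    (hlight : ∀ k, k₀ ≤ k → (c k).r a + (c k).r a' ≤ 2 * (c (k + 1)).r (j k))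
    (hfreeT : ∀ k, k₀ ≤ k → ∀ i, β k i ≠ 0 → (c k).r i = 0)
    {k₁ : ℕ} (hk₁ : k₀ ≤ k₁) (hj₁ : j k₁ = a') (hj₂ : j (k₁ + 1) = a)
    {f₁ f₂ : Fin 4} (hf₁₂ : f₁ ≠ f₂) (hf₁a : f₁ ≠ a) (hf₁a' : f₁ ≠ a') (hf₂a : f₂ ≠ a) (hf₂a' : f₂ ≠ a')
    (hfree₁ : (c (k₁ + 1)).r f₁ = 0 ∧ f₁ ∉ (c (k₁ + 1)).exc)
    (hfree₂ : (c (k₁ + 1)).r f₂ = 0 ∧ f₂ ∉ (c (k₁ + 1)).exc)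
    {α γ : Fin 4 → K} (hαs : ∀ i, i ≠ f₁ → i ≠ f₂ → α i = 0) (hγs : ∀ i, i ≠ f₁ → i ≠ f₂ → γ i = 0)
    (htilt : Pi.single a 1 + α ∈ resVertex (c (k₁ + 1)) ∧ Pi.single a' 1 + γ ∈ resVertex (c (k₁ + 1))) :
    False := by
  -- the initial-degree law for `a′` at the child of the `a′`-step `k₁`
  obtain ⟨o, ho, hpo, ho2⟩ := chain_band p hc hfloor k₁
  have hrk := IsolatedBand.isolated_chain_forall_le hc hr0
  have hstep := (hw k₁).2.2.2.2
  have hbj : β k₁ (j k₁) = 0 := (hw k₁).2.1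
  have heqsh : (CentreBlowup.step p Finset.univ (j k₁) (β k₁) (c k₁)).shade = (c k₁).shade :=
    chain_shade_step p hw hshade hk₁
  have hd : o - (c k₁).r.degree = d := ordZero_sub_degree_eq_of_shade ho (hshade k₁ hk₁)
  have hP : ∀ E ∈ (c (k₁ + 1)).F.support, E a' = (c (k₁ + 1)).r a' →
      E.degree = (c (k₁ + 1)).r.degree + d := by
    intro E hE hEa
    rw [hstep] at hE hEa ⊢
    rw [hj₁] at hE hEa hbj heqsh ⊢
    have h := degree_eq_of_mem_support_step_of_apply_eq a' hbj ho (hrk k₁) hpo ho2 heqsh (hfreeT k₁ hk₁) hE hEa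
    rw [hd] at h
    exact h
  -- the shifted tail from `m = k₁ + 1`
  set m := k₁ + 1 with hm
  have hwT : FreeTail.IsWitnessedChain p (fun k => c (m + k)) (fun k => j (m + k)) (fun k => β (m + k)) := by
    intro k
    have h := hw (m + k)
    rwa [show m + k + 1 = m + (k + 1) by ring] at h
  have hcT : ∀ k, IsIsolated p ((fun k => c (m + k)) k).F ∧
      Step0 p ((fun k => c (m + k)) k) ((fun k => c (m + k)) (k + 1)) := fun k => by
    have h := hc (m + k)
    rwa [show m + k + 1 = m + (k + 1) by ring] at h
  have hcleanT : deletePthPowers p (c (m + 0)).F = (c (m + 0)).F := by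
    rw [Nat.add_zero, hm, hstep]
    exact FrameChange.deletePthPowers_step_F p _ _ _ _
  have hjf₁ : ∀ k, j (m + k) ≠ f₁ := fun k => by
    rcases hletters (m + k) (by omega) with h | h <;> rw [h]
    · exact hf₁a.symm
    · exact hf₁a'.symm
  have hjf₂ : ∀ k, j (m + k) ≠ f₂ := fun k => by
    rcases hletters (m + k) (by omega) with h | h <;> rw [h]
    · exact hf₂a.symm
    · exact hf₂a'.symm
  have hm0 : c (m + 0) = c (k₁ + 1) := by rw [Nat.add_zero]
  -- first re-framing, along `f₁`
  set lam₁ : Fin 4 → K := fun i => if i = a then α f₁ else if i = a' then γ f₁ else 0 with hlam₁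
  have hlam₁f : lam₁ f₁ = 0 := by simp only [hlam₁, if_neg hf₁a, if_neg hf₁a']
  obtain ⟨c₁, b₁, hc₁, hw₁, hr0₁, hfloor₁, hclean₁, hshade₁, he₁, hfreeT₁, hreq₁, hV₁, hP₁⟩ :=
    exists_reframed_tail p hcT hwT (by rw [hm0]; exact hrk (k₁ + 1)) (fun k => hfloor (m + k)) hcleanT
      (fun k => hshade (m + k) (by omega)) (fun k => he (m + k) (by omega))
      (fun k i hbi => hfreeT (m + k) (by omega) i hbi) hjf₁ (by rw [hm0]; exact hfree₁.1)
      (by rw [hm0]; exact hfree₁.2) lam₁ hlam₁f hf₁a'.symm (N := (c (k₁ + 1)).r.degree + d)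
      (by rw [hm0]; exact hP)
  -- sums against `lam₁`, and the transported kernel vectors
  have hsum₁ : ∀ w : Fin 4 → K, w a' = 0 → ∑ i, lam₁ i * w i = α f₁ * w a := by
    intro w hwa'
    rw [Finset.sum_eq_single a]
    · simp only [hlam₁, if_true]
    · intro i _ hia
      simp only [hlam₁, if_neg hia]
      split_ifs with hia'
      · rw [hia', hwa', mul_zero]
      · rw [zero_mul]
    · intro h; exact absurd (Finset.mem_univ a) h
  have hsum₁' : ∀ w : Fin 4 → K, w a = 0 → ∑ i, lam₁ i * w i = γ f₁ * w a' := by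
    intro w hwa
    rw [Finset.sum_eq_single a']
    · simp only [hlam₁, if_neg haa.symm, if_true]
    · intro i _ hia'
      simp only [hlam₁, if_neg hia']
      split_ifs with hia
      · rw [hia, hwa, mul_zero]
      · rw [zero_mul]
    · intro h; exact absurd (Finset.mem_univ a') h
  have hαa : α a = 0 := hαs a hf₁a.symm hf₂a.symm
  have hαa' : α a' = 0 := hαs a' hf₁a'.symm hf₂a'.symm
  have hγa : γ a = 0 := hγs a hf₁a.symm hf₂a.symm
  have hγa' : γ a' = 0 := hγs a' hf₁a'.symm hf₂a'.symm
  have hva : (Pi.single a 1 + α : Fin 4 → K) a = 1 := by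
    rw [Pi.add_apply, Pi.single_eq_same, hαa, add_zero]
  have hva' : (Pi.single a 1 + α : Fin 4 → K) a' = 0 := by
    rw [Pi.add_apply, Pi.single_eq_of_ne haa.symm, hαa', add_zero]
  have hua : (Pi.single a' 1 + γ : Fin 4 → K) a = 0 := by
    rw [Pi.add_apply, Pi.single_eq_of_ne haa, hγa, add_zero]
  have hua' : (Pi.single a' 1 + γ : Fin 4 → K) a' = 1 := by
    rw [Pi.add_apply, Pi.single_eq_same, hγa', add_zero]
  -- `w₁ := e_a + α` with its `f₁`-coordinate zeroed lies in the kernel of `c₁ 0`; same for `u₁`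
  have hvf : (Pi.single a 1 + α : Fin 4 → K) f₁ = α f₁ := by
    rw [Pi.add_apply, Pi.single_eq_of_ne hf₁a, zero_add]
  have huf : (Pi.single a' 1 + γ : Fin 4 → K) f₁ = γ f₁ := by
    rw [Pi.add_apply, Pi.single_eq_of_ne hf₁a', zero_add]
  have hvalv : (Pi.single a 1 + α : Fin 4 → K) f₁ - ∑ i, lam₁ i * (Pi.single a 1 + α : Fin 4 → K) i = 0 := by
    rw [hsum₁ _ hva', hva, mul_one, hvf, sub_self]
  have hvalu : (Pi.single a' 1 + γ : Fin 4 → K) f₁ - ∑ i, lam₁ i * (Pi.single a' 1 + γ : Fin 4 → K) i = 0 := by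
    rw [hsum₁' _ hua, hua', mul_one, huf, sub_self]
  have hker₁ : Function.update (Pi.single a 1 + α : Fin 4 → K) f₁ 0 ∈ resVertex (c₁ 0) := by
    have h := update_mem_of_transport hlam₁f hV₁ (v := Pi.single a 1 + α) (by rw [hm0]; exact htilt.1)
    rwa [hvalv] at h
  have hker₁' : Function.update (Pi.single a' 1 + γ : Fin 4 → K) f₁ 0 ∈ resVertex (c₁ 0) := by
    have h := update_mem_of_transport hlam₁f hV₁ (v := Pi.single a' 1 + γ) (by rw [hm0]; exact htilt.2)
    rwa [hvalu] at h
  -- second re-framing, along `f₂`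
  set lam₂ : Fin 4 → K := fun i => if i = a then α f₂ else if i = a' then γ f₂ else 0 with hlam₂
  have hlam₂f : lam₂ f₂ = 0 := by simp only [hlam₂, if_neg hf₂a, if_neg hf₂a']
  obtain ⟨c₂, b₂, hc₂, hw₂, hr0₂, hfloor₂, -, hshade₂, he₂, hfreeT₂, hreq₂, hV₂, hP₂⟩ :=
    exists_reframed_tail p hc₁ hw₁ hr0₁ hfloor₁ hclean₁ hshade₁ he₁ hfreeT₁ hjf₂
      (by rw [(hreq₁ 0).1, hm0]; exact hfree₂.1) (by rw [(hreq₁ 0).2, hm0]; exact hfree₂.2) lam₂ hlam₂f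
      hf₂a'.symm hP₁
  have hsum₂ : ∀ w : Fin 4 → K, w a' = 0 → ∑ i, lam₂ i * w i = α f₂ * w a := by
    intro w hwa'
    rw [Finset.sum_eq_single a]
    · simp only [hlam₂, if_true]
    · intro i _ hia
      simp only [hlam₂, if_neg hia]
      split_ifs with hia'
      · rw [hia', hwa', mul_zero]
      · rw [zero_mul]
    · intro h; exact absurd (Finset.mem_univ a) h
  have hsum₂' : ∀ w : Fin 4 → K, w a = 0 → ∑ i, lam₂ i * w i = γ f₂ * w a' := by
    intro w hwa
    rw [Finset.sum_eq_single a']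
    · simp only [hlam₂, if_neg haa.symm, if_true]
    · intro i _ hia'
      simp only [hlam₂, if_neg hia']
      split_ifs with hia
      · rw [hia, hwa, mul_zero]
      · rw [zero_mul]
    · intro h; exact absurd (Finset.mem_univ a') h
  -- the frame at `c₂ 0`
  have hframe : (Pi.single a 1 : Fin 4 → K) ∈ resVertex (c₂ 0) ∧
      (Pi.single a' 1 : Fin 4 → K) ∈ resVertex (c₂ 0) := by
    constructor
    · have h := update_mem_of_transport hlam₂f hV₂ hker₁
      have h1 : Function.update (Pi.single a 1 + α : Fin 4 → K) f₁ 0 a' = 0 := by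
        rw [Function.update_of_ne hf₁a'.symm]; exact hva'
      have h2 : Function.update (Pi.single a 1 + α : Fin 4 → K) f₁ 0 a = 1 := by
        rw [Function.update_of_ne hf₁a.symm]; exact hva
      rw [hsum₂ _ h1, h2, mul_one] at h
      convert h using 1
      funext i
      by_cases hi₂ : i = f₂
      · subst hi₂
        rw [Function.update_self, Pi.single_eq_of_ne hf₂a]
        rw [Function.update_of_ne (Ne.symm hf₁₂), Pi.add_apply, Pi.single_eq_of_ne hf₂a, zero_add, sub_self]
      · rw [Function.update_of_ne hi₂]
        by_cases hi₁ : i = f₁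
        · subst hi₁
          rw [Function.update_self, Pi.single_eq_of_ne hf₁a]
        · rw [Function.update_of_ne hi₁, Pi.add_apply, hαs i hi₁ hi₂, add_zero]
    · have h := update_mem_of_transport hlam₂f hV₂ hker₁'
      have h1 : Function.update (Pi.single a' 1 + γ : Fin 4 → K) f₁ 0 a = 0 := by
        rw [Function.update_of_ne hf₁a.symm]; exact hua
      have h2 : Function.update (Pi.single a' 1 + γ : Fin 4 → K) f₁ 0 a' = 1 := by
        rw [Function.update_of_ne hf₁a'.symm]; exact hua'
      rw [hsum₂' _ h1, h2, mul_one] at h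
      convert h using 1
      funext i
      by_cases hi₂ : i = f₂
      · subst hi₂
        rw [Function.update_self, Pi.single_eq_of_ne hf₂a']
        rw [Function.update_of_ne (Ne.symm hf₁₂), Pi.add_apply, Pi.single_eq_of_ne hf₂a', zero_add, sub_self]
      · rw [Function.update_of_ne hi₂]
        by_cases hi₁ : i = f₁
        · subst hi₁
          rw [Function.update_self, Pi.single_eq_of_ne hf₁a']
        · rw [Function.update_of_ne hi₁, Pi.add_apply, hγs i hi₁ hi₂, add_zero]
  -- the entry theorem on the doubly re-framed tail
  have hr₂ : ∀ k, (c₂ k).r = (c (m + k)).r := fun k => by rw [(hreq₂ k).1, (hreq₁ k).1]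
  refine no_frame_of_initialDegree p hc₂ hw₂ hr0₂ hfloor₂ hdp (k₀ := 0) (fun k _ => hshade₂ k) haa
    (fun k _ => hletters (m + k) (by omega)) (fun k _ => he₂ k) (fun k _ => ?_) (fun k _ => ?_) (k₁ := 0)
    le_rfl (by show j (m + 0) = a; rw [Nat.add_zero]; exact hj₂) hframe (fun E hE hEa => ?_)
  · rw [hr₂ k]; exact hbdry (m + k) (by omega)
  · rw [hr₂ k, hr₂ (k + 1), show m + (k + 1) = m + k + 1 by ring]
    exact hlight (m + k) (by omega)
  · rw [hr₂ 0, Nat.add_zero]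
    exact hP₂ E hE hEa

end Transfer

end ResCone

end Summit.ResolutionOfSingularities.ResolutionOfSingularities.Theorems.PIDim4

end
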